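import Mathlib
import HarnessLib

/-!
# Coordinate averaging operators on a finite product space (counting form)

Topic `Literature/Probability/Moments`. For real functions `F : (ι → Γ) → ℝ` on a finite product
space (finitely many coordinates `ι`, finite alphabet `Γ`, uniform = counting measure) we define the
*coordinate averaging operators*

* `coordAvg S F` — average `F` over fresh uniform values of the coordinates in `S : Finset ι`
  (O'Donnell, *Analysis of Boolean Functions*, §8.3: the operator `E_S`, conditional expectation
  given the coordinates outside `S`),

and prove the operator calculus behind the Efron–Stein / Hoeffding (orthogonal, ANOVA) decomposition:
linearity; `E_∅ = id`; the semigroup law `E_S E_T = E_{S ∪ T}` (hence commutation and idempotence);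
self-adjointness for the counting inner product `Σ_y F y · G y`; invariance of juntas
(`Function.DependsOn`); the one-coordinate formula `E_{i} F (y) = |Γ|⁻¹ Σ_ℓ F (y[i ↦ ℓ])`; and the
*resampling-sensitivity identity*
`Σ_y Σ_ℓ (F y − F (y[i ↦ ℓ]))² = 2 |Γ| · Σ_y (F y − E_{i} F y)²` (twice the `L²`-influence of
coordinate `i`, counting normalisation). Everything is proved; no named facts. The orthogonal
decomposition itself and the degree bound on total influence are in `HoeffdingDecomposition.lean`.

Normalisation: `coordAvg S F y = (Σ_{z : ι → Γ} F (S.piecewise z y)) / #(ι → Γ)` — summing over ALL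
`z` (only `z|_S` matters; each restriction is hit `|Γ|^{|ι∖S|}` times) keeps every identity free of
`S`-dependent constants. If `Γ` is empty and `ι` is not, everything is the zero function (harmless).

References: R. O'Donnell, *Analysis of Boolean Functions*, CUP 2014, §8.3 (orthogonal decomposition,
operators `E_S`, `L²`-influences) [ODonnell2014]; B. Efron, C. Stein, Ann. Statist. 9 (1981)
[EfronStein1981].
-/

noncomputable section

namespace Literature.Probability.Moments

open Finset

variable {ι Γ : Type*} [Fintype ι] [DecidableEq ι] [Fintype Γ]

/-- **Coordinate averaging** `E_S` (O'Donnell 2014, §8.3): `coordAvg S F y` is the average of `F`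
over the points obtained from `y` by replacing the coordinates in `S` by fresh values, in counting
form `(Σ_z F (S.piecewise z y)) / #(ι → Γ)`. [cite: ODonnell2014, §8.3] -/
def coordAvg (S : Finset ι) (F : (ι → Γ) → ℝ) (y : ι → Γ) : ℝ :=
  (∑ z : ι → Γ, F (S.piecewise z y)) / Fintype.card (ι → Γ)

/-- Unfolding of `coordAvg`. [folklore] -/
theorem coordAvg_apply (S : Finset ι) (F : (ι → Γ) → ℝ) (y : ι → Γ) :
    coordAvg S F y = (∑ z : ι → Γ, F (S.piecewise z y)) / Fintype.card (ι → Γ) := rfl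

/-! ### Linearity -/

/-- `E_S` is additive. [folklore] -/
theorem coordAvg_add (S : Finset ι) (F G : (ι → Γ) → ℝ) :
    coordAvg S (fun y => F y + G y) = fun y => coordAvg S F y + coordAvg S G y := by
  funext y; simp only [coordAvg, sum_add_distrib, add_div]

/-- `E_S` commutes with subtraction. [folklore] -/
theorem coordAvg_sub (S : Finset ι) (F G : (ι → Γ) → ℝ) :
    coordAvg S (fun y => F y - G y) = fun y => coordAvg S F y - coordAvg S G y := by
  funext y; simp only [coordAvg, sum_sub_distrib, sub_div]

/-- `E_S` is homogeneous. [folklore] -/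
theorem coordAvg_smul (S : Finset ι) (c : ℝ) (F : (ι → Γ) → ℝ) :
    coordAvg S (fun y => c * F y) = fun y => c * coordAvg S F y := by
  funext y; simp only [coordAvg, ← mul_sum, mul_div_assoc]

/-- `E_S 0 = 0`. [folklore] -/
theorem coordAvg_zero (S : Finset ι) : coordAvg S (fun _ : ι → Γ => (0 : ℝ)) = fun _ => 0 := by
  funext y; simp [coordAvg]

/-- `E_S` commutes with finite sums. [folklore] -/
theorem coordAvg_sum {α : Type*} (S : Finset ι) (s : Finset α) (F : α → (ι → Γ) → ℝ) :
    coordAvg S (fun y => ∑ a ∈ s, F a y) = fun y => ∑ a ∈ s, coordAvg S (F a) y := by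
  funext y; simp only [coordAvg, ← sum_div]; rw [sum_comm]

/-! ### The semigroup law, self-adjointness -/

/-- `E_∅` is the identity. [folklore] -/
theorem coordAvg_empty [Nonempty Γ] (F : (ι → Γ) → ℝ) : coordAvg ∅ F = F := by
  funext y
  have hN : (Fintype.card (ι → Γ) : ℝ) ≠ 0 := by exact_mod_cast Fintype.card_ne_zero
  simp only [coordAvg, piecewise_empty, sum_const, card_univ, nsmul_eq_mul]
  field_simp

/-- A constant is averaged to itself. [folklore] -/
theorem coordAvg_const [Nonempty Γ] (S : Finset ι) (c : ℝ) :
    coordAvg S (fun _ : ι → Γ => c) = fun _ => c := by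
  funext y
  have hN : (Fintype.card (ι → Γ) : ℝ) ≠ 0 := by exact_mod_cast Fintype.card_ne_zero
  simp only [coordAvg, sum_const, card_univ, nsmul_eq_mul]
  field_simp

omit [Fintype ι] [Fintype Γ] in
/-- Swapping the `T`-coordinates of a pair of points: an involution of `(ι → Γ) × (ι → Γ)`.
[folklore] -/
theorem swapOn_involutive (T : Finset ι) :
    Function.Involutive (fun p : (ι → Γ) × (ι → Γ) => (T.piecewise p.2 p.1, T.piecewise p.1 p.2)) := by
  intro p
  ext j <;> by_cases hj : j ∈ T <;> simp [piecewise, hj]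

omit [Fintype ι] [Fintype Γ] in
/-- Iterated piecewise replacement: first the `S`-coordinates from `z`, then the `T`-coordinates
from `w`, is one replacement of the `S ∪ T`-coordinates from `T.piecewise w z`. [folklore] -/
theorem piecewise_piecewise_eq_union (S T : Finset ι) (z w y : ι → Γ) :
    T.piecewise w (S.piecewise z y) = (S ∪ T).piecewise (T.piecewise w z) y := by
  ext j
  by_cases hT : j ∈ T <;> by_cases hS : j ∈ S <;> simp [piecewise, hT, hS]

/-- **Semigroup law** `E_S (E_T F) = E_{S ∪ T} F` (O'Donnell 2014, §8.3, Prop. 8.32/Ex. 8.18: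
the `E_S` commute and compose by union). [cite: ODonnell2014, §8.3] -/
theorem coordAvg_coordAvg [Nonempty Γ] (S T : Finset ι) (F : (ι → Γ) → ℝ) :
    coordAvg S (coordAvg T F) = coordAvg (S ∪ T) F := by
  funext y
  have hN : (Fintype.card (ι → Γ) : ℝ) ≠ 0 := by exact_mod_cast Fintype.card_ne_zero
  simp only [coordAvg, ← sum_div]
  rw [div_div, div_eq_div_iff (mul_ne_zero hN hN) hN]
  -- `Σ_z Σ_w F (T.pw w (S.pw z y)) = #(ι → Γ) · Σ_u F ((S ∪ T).pw u y)`
  have key : ∑ z : ι → Γ, ∑ w : ι → Γ, F (T.piecewise w (S.piecewise z y)) =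
      ∑ u : ι → Γ, ∑ _u' : ι → Γ, F ((S ∪ T).piecewise u y) := by
    calc ∑ z : ι → Γ, ∑ w : ι → Γ, F (T.piecewise w (S.piecewise z y))
        = ∑ p : (ι → Γ) × (ι → Γ), F ((S ∪ T).piecewise (T.piecewise p.2 p.1) y) := by
          rw [Fintype.sum_prod_type]
          simp_rw [piecewise_piecewise_eq_union S T]
      _ = ∑ p : (ι → Γ) × (ι → Γ), F ((S ∪ T).piecewise p.1 y) :=
          Fintype.sum_equiv (swapOn_involutive (Γ := Γ) T).toPerm _ _ fun p => rfl
      _ = ∑ u : ι → Γ, ∑ _u' : ι → Γ, F ((S ∪ T).piecewise u y) := by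
          rw [Fintype.sum_prod_type]
  rw [key]
  simp only [sum_const, card_univ, nsmul_eq_mul]
  rw [← mul_sum]
  ring

/-- The averaging operators commute. [cite: ODonnell2014, §8.3] -/
theorem coordAvg_comm [Nonempty Γ] (S T : Finset ι) (F : (ι → Γ) → ℝ) :
    coordAvg S (coordAvg T F) = coordAvg T (coordAvg S F) := by
  rw [coordAvg_coordAvg, coordAvg_coordAvg, union_comm]

/-- Each averaging operator is idempotent (a projection). [cite: ODonnell2014, §8.3] -/
theorem coordAvg_idem [Nonempty Γ] (S : Finset ι) (F : (ι → Γ) → ℝ) :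
    coordAvg S (coordAvg S F) = coordAvg S F := by
  rw [coordAvg_coordAvg, union_idempotent]

/-- **Self-adjointness** of `E_S` for the counting inner product:
`Σ_y (E_S F) y · G y = Σ_y F y · (E_S G) y`. [cite: ODonnell2014, §8.3] -/
theorem sum_coordAvg_mul (S : Finset ι) (F G : (ι → Γ) → ℝ) :
    ∑ y, coordAvg S F y * G y = ∑ y, F y * coordAvg S G y := by
  simp only [coordAvg, div_mul_eq_mul_div, mul_div_assoc', ← sum_div, sum_mul, mul_sum]
  congr 1
  calc ∑ y : ι → Γ, ∑ z : ι → Γ, F (S.piecewise z y) * G y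
      = ∑ p : (ι → Γ) × (ι → Γ), F (S.piecewise p.2 p.1) * G p.1 := by
        rw [Fintype.sum_prod_type]
    _ = ∑ p : (ι → Γ) × (ι → Γ), F p.1 * G (S.piecewise p.2 p.1) := by
        refine Fintype.sum_equiv (swapOn_involutive (Γ := Γ) S).toPerm _ _ fun p => ?_
        -- the involution `(y, z) ↦ (S.pw z y, S.pw y z)` exchanges the two integrands
        show F (S.piecewise p.2 p.1) * G p.1 =
          F (S.piecewise p.2 p.1) * G (S.piecewise (S.piecewise p.1 p.2) (S.piecewise p.2 p.1))
        have h : S.piecewise (S.piecewise p.1 p.2) (S.piecewise p.2 p.1) = p.1 := by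
          ext j; by_cases hj : j ∈ S <;> simp [piecewise, hj]
        rw [h]
    _ = ∑ y : ι → Γ, ∑ z : ι → Γ, F y * G (S.piecewise z y) := by
        rw [Fintype.sum_prod_type]

/-- The squared norm of a projection: `Σ_y (E_S F) y ² = Σ_y F y · (E_S F) y`. [folklore] -/
theorem sum_coordAvg_sq [Nonempty Γ] (S : Finset ι) (F : (ι → Γ) → ℝ) :
    ∑ y, coordAvg S F y ^ 2 = ∑ y, F y * coordAvg S F y := by
  have h := sum_coordAvg_mul S F (coordAvg S F)
  rw [coordAvg_idem] at h
  simpa only [sq] using h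

/-- `Σ_y (F y − E_S F y)² = Σ_y F y² − Σ_y F y · E_S F y` (Pythagoras for the projection `E_S`).
[folklore] -/
theorem sum_sub_coordAvg_sq [Nonempty Γ] (S : Finset ι) (F : (ι → Γ) → ℝ) :
    ∑ y, (F y - coordAvg S F y) ^ 2 = ∑ y, F y ^ 2 - ∑ y, F y * coordAvg S F y := by
  have h := sum_coordAvg_sq S F
  simp only [sub_sq, sum_add_distrib, sum_sub_distrib, h]
  have : ∑ y, 2 * F y * coordAvg S F y = 2 * ∑ y, F y * coordAvg S F y := by
    rw [mul_sum]; refine sum_congr rfl fun y _ => by ring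
  rw [this]; ring

/-! ### Juntas -/

/-- A function not depending on the coordinates in `S` is fixed by `E_S`. [folklore] -/
theorem coordAvg_eq_self_of_dependsOn [Nonempty Γ] {S : Finset ι} {A : Set ι} {F : (ι → Γ) → ℝ}
    (hF : DependsOn F A) (hSA : ∀ j ∈ S, j ∉ A) : coordAvg S F = F := by
  funext y
  have hN : (Fintype.card (ι → Γ) : ℝ) ≠ 0 := by exact_mod_cast Fintype.card_ne_zero
  have h : ∀ z : ι → Γ, F (S.piecewise z y) = F y := fun z =>
    hF fun j hj => by
      have : j ∉ S := fun h => hSA j h hj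
      simp [piecewise, this]
  simp only [coordAvg, h, sum_const, card_univ, nsmul_eq_mul]
  field_simp

/-- `E_S F` does not depend on the coordinates in `S`. [folklore] -/
theorem dependsOn_coordAvg_compl (S : Finset ι) (F : (ι → Γ) → ℝ) :
    DependsOn (coordAvg S F) {j | j ∉ S} := by
  intro y y' h
  simp only [coordAvg]
  congr 1
  refine sum_congr rfl fun z _ => ?_
  congr 1
  ext j
  by_cases hj : j ∈ S
  · simp [piecewise, hj]
  · simp [piecewise, hj, h j hj]

/-- Averaging preserves junta structure: if `F` depends only on `A` then so does `E_S F`.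
[folklore] -/
theorem DependsOn.coordAvg {A : Set ι} {F : (ι → Γ) → ℝ} (hF : DependsOn F A) (S : Finset ι) :
    DependsOn (coordAvg S F) A := by
  intro y y' h
  simp only [Literature.Probability.Moments.coordAvg]
  congr 1
  refine sum_congr rfl fun z _ => hF fun j hj => ?_
  by_cases hjS : j ∈ S
  · simp [piecewise, hjS]
  · simp [piecewise, hjS, h j hj]

/-! ### One coordinate -/

/-- **One-coordinate formula**: `E_{i} F (y) = |Γ|⁻¹ Σ_ℓ F (y[i ↦ ℓ])`. [cite: ODonnell2014, §8.3] -/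
theorem coordAvg_singleton [Nonempty Γ] (i : ι) (F : (ι → Γ) → ℝ) (y : ι → Γ) :
    coordAvg {i} F y = (∑ ℓ : Γ, F (Function.update y i ℓ)) / Fintype.card Γ := by
  have hΓ : (Fintype.card Γ : ℝ) ≠ 0 := by exact_mod_cast Fintype.card_ne_zero
  have hR : (Fintype.card ({j // j ≠ i} → Γ) : ℝ) ≠ 0 := by exact_mod_cast Fintype.card_ne_zero
  simp only [coordAvg, piecewise_singleton]
  -- split `z ↦ (z i, z|_{≠ i})`
  have hsum : ∑ z : ι → Γ, F (Function.update y i (z i)) =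
      ∑ p : Γ × ({j // j ≠ i} → Γ), F (Function.update y i p.1) :=
    Fintype.sum_equiv (Equiv.funSplitAt i Γ) _ _ fun z => rfl
  have hcard : (Fintype.card (ι → Γ) : ℝ) = Fintype.card Γ * Fintype.card ({j // j ≠ i} → Γ) := by
    rw [Fintype.card_congr (Equiv.funSplitAt i Γ), Fintype.card_prod]; push_cast; ring
  rw [hsum, Fintype.sum_prod_type, hcard]
  simp only [sum_const, card_univ, nsmul_eq_mul]
  rw [← mul_sum, mul_comm, mul_div_mul_right _ _ hR]

/-- Re-counting the resampled points: `Σ_y Σ_ℓ G (y[i ↦ ℓ]) = |Γ| · Σ_y G y`. [folklore] -/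
theorem sum_sum_update_eq [Nonempty Γ] (i : ι) (G : (ι → Γ) → ℝ) :
    ∑ y : ι → Γ, ∑ ℓ : Γ, G (Function.update y i ℓ) = Fintype.card Γ * ∑ y, G y := by
  have hΓ : (Fintype.card Γ : ℝ) ≠ 0 := by exact_mod_cast Fintype.card_ne_zero
  have h : ∀ y : ι → Γ, ∑ ℓ : Γ, G (Function.update y i ℓ) = Fintype.card Γ * coordAvg {i} G y := by
    intro y; rw [coordAvg_singleton]; field_simp
  simp_rw [h]
  rw [← mul_sum]
  congr 1
  have := sum_coordAvg_mul {i} G (fun _ => (1 : ℝ))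
  simp only [mul_one, coordAvg_const, mul_one] at this
  exact this

/-- **Resampling-sensitivity identity** (counting form of
`E_{y,ℓ}[(F(y) − F(y^{(i←ℓ)}))²] = 2·Inf_i[F]`, O'Donnell 2014 §8.3, `L²`-influences): for every
coordinate `i`,
`Σ_y Σ_ℓ (F y − F (y[i ↦ ℓ]))² = 2 |Γ| · Σ_y (F y − E_{i} F y)²`. [cite: ODonnell2014, §8.3] -/
theorem sum_sum_sq_sub_update_eq [Nonempty Γ] (i : ι) (F : (ι → Γ) → ℝ) :
    ∑ y : ι → Γ, ∑ ℓ : Γ, (F y - F (Function.update y i ℓ)) ^ 2 =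
      2 * Fintype.card Γ * ∑ y, (F y - coordAvg {i} F y) ^ 2 := by
  have hΓ : (Fintype.card Γ : ℝ) ≠ 0 := by exact_mod_cast Fintype.card_ne_zero
  -- expand the square
  have hexp : ∀ y : ι → Γ, ∑ ℓ : Γ, (F y - F (Function.update y i ℓ)) ^ 2 =
      Fintype.card Γ * F y ^ 2 - 2 * F y * (Fintype.card Γ * coordAvg {i} F y) +
        ∑ ℓ : Γ, F (Function.update y i ℓ) ^ 2 := by
    intro y
    have h1 : (Fintype.card Γ : ℝ) * coordAvg {i} F y = ∑ ℓ : Γ, F (Function.update y i ℓ) := by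
      rw [coordAvg_singleton]; field_simp
    rw [h1]
    simp only [sub_sq, sum_add_distrib, sum_sub_distrib, sum_const, card_univ, nsmul_eq_mul,
      mul_sum]
  simp_rw [hexp]
  rw [sum_add_distrib, sum_sub_distrib, sum_sum_update_eq i (fun y => F y ^ 2),
    sum_sub_coordAvg_sq]
  have h2 : ∑ y : ι → Γ, 2 * F y * (Fintype.card Γ * coordAvg {i} F y) =
      2 * Fintype.card Γ * ∑ y, F y * coordAvg {i} F y := by
    rw [mul_sum]; refine sum_congr rfl fun y _ => by ring
  rw [h2, ← mul_sum]
  ring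

end Literature.Probability.Moments

end
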